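import Summits.Ventures.PercRepro.Night2ThreeTwoMissedGlobal

/-!
# PercRepro — the cell `(3, 2)`: the covering bases of a target counted along a line (night-2, gen 25)

The first piece of the basis pairs' inequality (ii) of the obstruction cell (proofs/NIGHT-2-g25.md §5′–§5″): an independent
set meets a rank-`2` set in at most two points, so the covering bases of a target `S` are `4`-subsets of `S ∖ K` with at
most two points on a line `ℓ` — at most `C(i, 2)·C(j, 2) + i·C(j, 3) + C(j, 4)` of them, `i = |(S ∖ K) ∩ ℓ|`,
`j = |(S ∖ K) ∖ ℓ|`: QUADRATIC in the line, against the `C(i + j, 4)` of the size-only count.  For `|G ∖ K| ≥ 11` the cell has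
such a line through every big hyperplane (`exists_common_line`).

* `card_inter_le_two_of_indep`: an independent finset meets a rank-`≤ 2` finset in `≤ 2` points;
* `card_filter_inter_card_eq_le`, `card_powersetCard_four_le_lineCount`: the `4`-subsets of `X = A ⊔ Y` with `≤ 2` points in
  `A` number at most `C(|A|,2)C(|Y|,2) + |A|·C(|Y|,3) + C(|Y|,4)`;
* **`card_coverBases_le_lineCount`**: the covering bases of `S` along a line;
* **`exists_common_line`**: for `|G ∖ K| ≥ 11` a rank-`2` subset of `G ∖ K` with `≥ 5` points inside every hyperplane of a
  thin member missing `≤ 3` points.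
-/

namespace PercRepro.Shadow

open Finset PerFlat ThmH

variable {α : Type*} [DecidableEq α] {M : Matroid α} [M.Finite]

section LineCount

/-- An independent finset meets a finset of rank `≤ 2` in at most two points. -/
theorem card_inter_le_two_of_indep {T ℓ : Finset α} (hT : M.Indep (T : Set α)) (hℓ : rkN M ℓ ≤ 2) :
    (T ∩ ℓ).card ≤ 2 := by
  have hI : M.Indep ((T ∩ ℓ : Finset α) : Set α) := hT.subset (by exact_mod_cast Finset.inter_subset_left)
  have h1 : rkN M (T ∩ ℓ) = (T ∩ ℓ).card := by
    have h := hI.eRk_eq_encard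
    rw [eRk_eq_rkN, Set.encard_coe_eq_coe_finsetCard] at h
    exact_mod_cast h
  have h2 : rkN M (T ∩ ℓ) ≤ rkN M ℓ := rkN_mono Finset.inter_subset_right
  omega

/-- The count `C(a,2)C(y,2) + a·C(y,3) + C(y,4)` of the `4`-subsets with at most two points on the line. -/
def lineCount (a y : ℕ) : ℕ := a.choose 2 * y.choose 2 + a * y.choose 3 + y.choose 4

omit [M.Finite] in
/-- The `4`-subsets of `X` with exactly `t` points in `A` inject into the pairs `(T ∩ A, T ∖ A)`. -/
theorem card_filter_inter_card_eq_le (X A : Finset α) (t : ℕ) :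
    ((X.powersetCard 4).filter (fun T => (T ∩ A).card = t)).card ≤ A.card.choose t * (X \ A).card.choose (4 - t) := by
  rw [← Finset.card_powersetCard, ← Finset.card_powersetCard, ← Finset.card_product]
  apply Finset.card_le_card_of_injOn (fun T => (T ∩ A, T \ A))
  · intro T hT
    rw [Finset.mem_coe, Finset.mem_filter, Finset.mem_powersetCard] at hT
    rw [Finset.mem_coe, Finset.mem_product, Finset.mem_powersetCard, Finset.mem_powersetCard]
    refine ⟨⟨Finset.inter_subset_right, hT.2⟩, Finset.sdiff_subset_sdiff hT.1.1 (Finset.Subset.refl _), ?_⟩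
    have := Finset.card_sdiff_add_card_inter T A
    show (T \ A).card = 4 - t
    omega
  · intro T _ T' _ h
    simp only [Prod.mk.injEq] at h
    rw [← Finset.sdiff_union_inter T A, ← Finset.sdiff_union_inter T' A, h.1, h.2]

omit [M.Finite] in
/-- **The `4`-subsets of `X` with at most two points in `A` number at most `lineCount |A| |X ∖ A|`.** -/
theorem card_powersetCard_four_le_lineCount (X A : Finset α) :
    ((X.powersetCard 4).filter (fun T => (T ∩ A).card ≤ 2)).card ≤ lineCount A.card (X \ A).card := by
  rw [Finset.card_eq_sum_card_fiberwise (f := fun T => (T ∩ A).card) (t := Finset.range 3)]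
  · have h : ∀ t ∈ Finset.range 3,
        (((X.powersetCard 4).filter (fun T => (T ∩ A).card ≤ 2)).filter (fun T => (T ∩ A).card = t)).card ≤
          A.card.choose t * (X \ A).card.choose (4 - t) := by
      intro t ht
      refine le_trans (Finset.card_le_card ?_) (card_filter_inter_card_eq_le X A t)
      intro T hT
      rw [Finset.mem_filter, Finset.mem_filter] at hT
      exact Finset.mem_filter.2 ⟨hT.1.1, hT.2⟩
    refine (Finset.sum_le_sum h).trans (le_of_eq ?_)
    rw [Finset.sum_range_succ, Finset.sum_range_succ, Finset.sum_range_succ, Finset.sum_range_zero]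
    unfold lineCount
    simp only [Nat.choose_zero_right, Nat.choose_one_right, Nat.sub_zero]
    ring
  · intro T hT
    rw [Finset.mem_coe, Finset.mem_filter] at hT
    rw [Finset.mem_coe, Finset.mem_range]
    show (T ∩ A).card < 3
    omega

variable {G : Finset α}

open scoped Classical in
/-- **The covering bases of a target along a line**: with `ℓ` of rank `≤ 2`, `#coverBases(S) ≤ lineCount i j`,
`i = |(S ∖ K) ∩ ℓ|`, `j = |(S ∖ K) ∖ ℓ|`. -/
theorem card_coverBases_le_lineCount (S ℓ : Finset α) (hℓ : rkN M ℓ ≤ 2) :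
    (coverBases M G S 4).card ≤ lineCount ((S \ coloops M G) ∩ ℓ).card ((S \ coloops M G) \ ℓ).card := by
  have hsub : coverBases M G S 4 ⊆
      ((S \ coloops M G).powersetCard 4).filter (fun T => (T ∩ ((S \ coloops M G) ∩ ℓ)).card ≤ 2) := by
    intro T hT
    unfold coverBases at hT
    rw [Finset.mem_filter] at hT
    rw [Finset.mem_filter]
    refine ⟨hT.1, ?_⟩
    have hTI : M.Indep (T : Set α) := hT.2.subset (by exact_mod_cast Finset.subset_union_right)
    calc (T ∩ ((S \ coloops M G) ∩ ℓ)).card ≤ (T ∩ ℓ).card :=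
          Finset.card_le_card (Finset.inter_subset_inter (Finset.Subset.refl _) Finset.inter_subset_right)
      _ ≤ 2 := card_inter_le_two_of_indep hTI hℓ
  have := (Finset.card_le_card hsub).trans
    (card_powersetCard_four_le_lineCount (S \ coloops M G) ((S \ coloops M G) ∩ ℓ))
  have he : (S \ coloops M G) \ ((S \ coloops M G) ∩ ℓ) = (S \ coloops M G) \ ℓ := by
    ext a
    simp only [Finset.mem_sdiff, Finset.mem_inter]
    tauto
  rwa [he] at this

open scoped Classical in
/-- **The common line of the cell** (`|G ∖ K| ≥ 11`): given two thin members missing `≤ 3` points with distinct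
hyperplanes, the set `ℓ = (cl B₁ ∩ cl B₂) ∖ K` has rank `≤ 2`, at least `5` points, and lies in the hyperplane of every thin
member missing `≤ 3` points. -/
theorem exists_common_line (hG : G ∈ flatsQ M (5 + 1)) (hd : (gr M \ G).card ≤ 5) (hk : kColoops M G = 2)
    (hs : ∀ e ∈ gr M, ∀ f ∈ gr M, e ≠ f → rkN M {e, f} = 2) (h11 : 11 ≤ (G \ coloops M G).card)
    {B₁ B₂ : Finset α} (hthin₁ : B₁ ∈ thinMembers M 5 G) (hthin₂ : B₂ ∈ thinMembers M 5 G)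
    (hm₁ : (G \ clF M B₁).card ≤ 3) (hm₂ : (G \ clF M B₂).card ≤ 3) (hne : clF M B₁ ≠ clF M B₂) :
    rkN M ((clF M B₁ ∩ clF M B₂) \ coloops M G) ≤ 2 ∧
      5 ≤ ((clF M B₁ ∩ clF M B₂) \ coloops M G).card ∧
      ∀ B ∈ thinMembers M 5 G, (G \ clF M B).card ≤ 3 →
        (clF M B₁ ∩ clF M B₂) \ coloops M G ⊆ clF M B := by
  refine ⟨rkN_inter_clF_sdiff_coloops_le_two hG hd hk hthin₁ hthin₂ hne, ?_, ?_⟩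
  · have hHG₁ : clF M B₁ ⊆ G := (mem_membersIn.1 (mem_thinMembers.1 hthin₁).1).2
    have hsub : ((G \ coloops M G) \ (G \ clF M B₁)) \ (G \ clF M B₂) ⊆ (clF M B₁ ∩ clF M B₂) \ coloops M G := by
      intro a ha
      simp only [Finset.mem_sdiff, not_and, not_not] at ha
      obtain ⟨⟨⟨haG, haK⟩, h1⟩, h2⟩ := ha
      exact Finset.mem_sdiff.2 ⟨Finset.mem_inter.2 ⟨h1 haG, h2 haG⟩, haK⟩
    have hc := Finset.card_le_card hsub
    have e1 := Finset.le_card_sdiff (G \ clF M B₁) (G \ coloops M G)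
    have e2 := Finset.le_card_sdiff (G \ clF M B₂) ((G \ coloops M G) \ (G \ clF M B₁))
    omega
  · intro B hB hm
    have := inter_clF_subset_of_three_eleven hG hd hk hs h11 hthin₁ hthin₂ hB hm₁ hm₂ hm hne
    exact fun a ha => this (Finset.mem_sdiff.1 ha).1

end LineCount

end PercRepro.Shadow
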